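import Summits.ABC.IUTFork.Conditional.AbcOfSGenuineKLinUniform
import Summits.ABC.IUTFork.Conditional.AbcOfSGenuineMShrinkDepthHex
import HarnessLib

/-!
# M LINE twin of the local-type-uniform [LIN] refutation at rational points: at abc-iut-s2-p8's summand-route M-level sharp setting of a genuine
# datum's OWN read-off ideles, `d + a + b < B + 1 + 1/(p−2)` at every member of the M-fibre over a pole prime `p ∉ {2,3,5,l}` ⇒ ¬ S_H — unconditionally

PROOF-ONLY file (no `def`, no new `Prop`, no instance) of the abc-iut cell (WAVE-5 prover seat abc-iut-w5-d107, gen 7; M twin of this seat's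
`AbcOfSGenuineKLinUniform` p464182). TAKES NO SIDE on [IUTchIII] Cor. 3.12 or on any author. NO new engine: abc-iut-w5-d166's M-line per-datum [LIN] socket
`GenuineMShrink2.not_pilotKummerCompatHull_of_explicit_depth` (`AbcOfSGenuineMShrinkDepth`; this seat's route via `not_licence_settingPrVolSharpM_tThetaM_of_explicit_depth`)
fed with (i) the read-off q-idele's norm `‖t_{q,x₀}‖ ≤ p^{−h/(2l)}` at every member `x₀` of the M-fibre `V̲_u` over a pole prime of `j(λ)`
(`placeModOfM_mem_S_and_norm_tqM_le_of_ratPoint`, `Cor312PilotIdelesMReadDeep`), (ii) abc-iut-W-neg-1's local-type lemma at the `K`-place `placeOfM` under the member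
(`Cor22.ThetaVolumeDatumAt.ramificationIdx_int_dvd_thirty_mul_ratPoint'`: `e ∣ 30·l`; the M-level local field `kOfM` IS the rescaled completion of `K` there), and
(iii) this seat's uniform bound `depthConstants_le_of_not_dvd_of_lt_pow` (`p ∤ e`, `e < p^B(p−1)` ⇒ `d + a + b ≤ B + 1 + 1/(p−2) − 1/e`).

* `GenuineM.not_pilotKummerCompatHull_ratPoint_of_linUniform` — `λ ∈ ℚ`, `T` at `(ratPoint λ, l)`, a finite place `u` of `ℚ` with `p_u ∉ {2, 3, 5, l}` and
  `ord_{p_u} j(λ) ≤ −h`, `B` with `30·l < p^B·(p−1)`, a label `i₀ + 1 ≤ l⋆` with **`2l·((i₀+2)·((B+1)(p−2)+1) + (p−2)) ≤ h·i₀(i₀+2)·(p−2)`** ⇒ the hull-level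
  clause S_H at the M-level sharp setting (own ideles, pinned reading — the per-datum object of the M-line window binders, `abc_of_SH_v11M_window` /
  M stable companions) FAILS for every choice of the free context binders and Kummer datum; `…_triple_of_linUniform` — abc-triple form (`p^v ∣ abc`, `h = 2v`).
HONEST SCOPE as in the parents: SHARP reading; per-label licence STRONGER than print; admissibility / Szpiro-badness / non-emptiness NOT claimed; «refuted as
typed» ≠ «refuted in print»; nothing about the number-level Corollary; typed ≠ proved; instantiated ≠ endorsed.
[cite: Mochizuki2012, IUTchIII Cor. 3.12 Step (xi-f) p. 184; IUTchIV Prop. 1.2 p. 10, Cor. 2.2 (ii) proof (P5) p. 46] [cite: DupuyHilado2025, §3.3, §3.4, §4.10]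
[cite: SerreLocalFields1979, Ch. III §6 Prop. 13] [claim: Mochizuki2012, status: disputed] for every IUT sentence quoted.
-/

noncomputable section

open Set Function NumberField IsDedekindDomain

namespace Summit.ABC.IUTFork.Conditional

open Thm311 Thm311.Real Cor312 Cor312Vol Cor312Prov Literature.IUT.LogThetaLattice Literature.IUT.LogVolume
  Literature.IUT.HodgeTheaters Literature.IUT.LogVolume.ThetaData Literature.IUT.LogVolume.Cor22
open Literature.NumberTheory.NumberFields Literature.NumberTheory.GaloisRepresentations.Ultrametric
open Literature.NumberTheory.DiophantineGeometry Literature.NumberTheory.DiophantineGeometry.GenEll Summit.ABC.ABC.Theorems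

/-- `p ∤ e` for `e ∣ 30·l` and a prime `p ∉ {2, 3, 5, l}` (`l` prime). [folklore] -/
theorem LinUniformM.not_dvd_of_dvd_thirty_mul {p l e : ℕ} (hp : p.Prime) (hl : l.Prime) (hp2 : p ≠ 2) (hp3 : p ≠ 3) (hp5 : p ≠ 5)
    (hpl : p ≠ l) (he : e ∣ 30 * l) : ¬ p ∣ e := by
  intro h
  have h' : p ∣ 30 * l := h.trans he
  rcases (Nat.Prime.dvd_mul hp).1 h' with h30 | hll
  · have h235 : p ∣ 2 * 3 * 5 := by norm_num; exact h30
    rcases (Nat.Prime.dvd_mul hp).1 h235 with h23 | h5'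
    · rcases (Nat.Prime.dvd_mul hp).1 h23 with h2' | h3'
      · exact hp2 ((Nat.prime_dvd_prime_iff_eq hp Nat.prime_two).1 h2')
      · exact hp3 ((Nat.prime_dvd_prime_iff_eq hp Nat.prime_three).1 h3')
    · exact hp5 ((Nat.prime_dvd_prime_iff_eq hp Nat.prime_five).1 h5')
  · exact hpl ((Nat.prime_dvd_prime_iff_eq hp hl).1 hll)

/-- **M LINE: UNCONDITIONAL [LIN] REFUTATION AT A RATIONAL POINT, UNIFORM IN THE LOCAL TYPE.** `λ ∈ ℚ`, `T` a genuine Θ-volume datum at `(ratPoint λ, l)`,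
`u` a finite place of `ℚ` with residue characteristic `p = p_u ∉ {2, 3, 5, l}` at which `j(λ)` has a pole of order `≥ h ≥ 1`, `B : ℕ` with `30·l < p^B·(p−1)`,
a label `j = i₀+1 ≤ l⋆` with the integer test **`2l·((i₀+2)·((B+1)(p−2)+1) + (p−2)) ≤ h·i₀(i₀+2)·(p−2)`**. THEN the hull-level clause S_H at abc-iut-s2-p8's
summand-route M-level sharp setting of `T`'s own read-off ideles (pinned reading) FAILS for every choice of the free context binders and Kummer datum.
[cite: Mochizuki2012, IUTchIV Prop. 1.2 p. 10, Cor. 2.2 (ii) proof (P5) p. 46; IUTchIII Cor. 3.12 Step (xi-f) p. 184] [claim: Mochizuki2012, status: disputed] -/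
theorem GenuineM.not_pilotKummerCompatHull_ratPoint_of_linUniform {q : ℚ} {l : ℕ}
    (T : Cor22.ThetaVolumeDatumAt (ratPoint q) l) (u : FinitePlace ℚ) (hp2 : ratChar u ≠ 2) (hp3 : ratChar u ≠ 3) (hp5 : ratChar u ≠ 5)
    (hpl : ratChar u ≠ l) (B : ℕ) (hB : 30 * l < ratChar u ^ B * (ratChar u - 1)) (h : ℕ) (hh : 1 ≤ h)
    (hord : ∀ u' : HeightOneSpectrum (𝓞 ℚ), Rat.HeightOneSpectrum.natGenerator u' = ratChar u → ord ℚ u' (Cor22.jInv q) ≤ -(h : ℤ))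
    (i₀ : ℕ) (hil : i₀ + 1 ≤ (l - 1) / 2)
    (htest : 2 * l * ((i₀ + 2) * ((B + 1) * (ratChar u - 2) + 1) + (ratChar u - 2)) ≤ h * (i₀ * (i₀ + 2)) * (ratChar u - 2)) :
    letI := T.instFieldF; letI := T.instNumberFieldF; letI := T.instAlgebraF; letI := T.instFieldK
    letI := T.instNumberFieldK; letI := T.instAlgebraK; letI := T.instFieldFbar; letI := T.instAlgebraFbar
    letI := T.instAlgebraKFbar; letI := T.instIsElliptic
    ∀ (M : Type) [Field M] [NumberField M]
      (archPk : ∀ (j : (thetaIndexOfInitial T.D).Label) (vQ : (thetaIndexOfInitial T.D).VQ),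
        Set ((logShellsOfInitialDH T.D (analyticLogvVal T.K)).Packet j vQ))
      (archSub : ∀ (j : (thetaIndexOfInitial T.D).Label) (v : (thetaIndexOfInitial T.D).V),
        Set ((logShellsOfInitialDH T.D (analyticLogvVal T.K)).Packet j ((thetaIndexOfInitial T.D).over v)))
      (Ψ : ℤ → ∀ v : (thetaIndexOfInitial T.D).V, v ∈ (thetaIndexOfInitial T.D).Vbad →
        Set ((logShellsOfInitialDH T.D (analyticLogvVal T.K)).StarPacket v))
      (act : ℤ → ∀ v : (thetaIndexOfInitial T.D).V, v ∈ (thetaIndexOfInitial T.D).Vbad →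
        (logShellsOfInitialDH T.D (analyticLogvVal T.K)).StarPacket v →
          Module.End ℚ ((logShellsOfInitialDH T.D (analyticLogvVal T.K)).StarPacket v))
      (Mmod : ℤ → ∀ j : (thetaIndexOfInitial T.D).LabelStar, Set ((logShellsOfInitialDH T.D (analyticLogvVal T.K)).GlobalPacket j.1))
      (region : ℤ → ∀ j : (thetaIndexOfInitial T.D).LabelStar, FinDivisor M → ∀ vQ : (thetaIndexOfInitial T.D).VQ,
        Set ((logShellsOfInitialDH T.D (analyticLogvVal T.K)).Packet j.1 vQ))
      (frobAdm : ℤ → ℤ → ∀ (j : (thetaIndexOfInitial T.D).Label) (vQ : (thetaIndexOfInitial T.D).VQ),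
        Set ((logShellsOfInitialDH T.D (analyticLogvVal T.K)).Packet j vQ) → Prop)
      (frobLogvol : ℤ → ℤ → ∀ (j : (thetaIndexOfInitial T.D).Label) (vQ : (thetaIndexOfInitial T.D).VQ),
        Set ((logShellsOfInitialDH T.D (analyticLogvVal T.K)).Packet j vQ) → ℝ)
      (frobΨ : ℤ → ℤ → ∀ v : (thetaIndexOfInitial T.D).V, v ∈ (thetaIndexOfInitial T.D).Vbad →
        Set ((logShellsOfInitialDH T.D (analyticLogvVal T.K)).StarPacket v))
      (frobMmod : ℤ → ℤ → ∀ j : (thetaIndexOfInitial T.D).LabelStar, Set ((logShellsOfInitialDH T.D (analyticLogvVal T.K)).GlobalPacket j.1))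
      (unitImage : ℤ → ℤ → ℕ → ∀ (j : (thetaIndexOfInitial T.D).Label) (vQ : (thetaIndexOfInitial T.D).VQ),
        Set ((logShellsOfInitialDH T.D (analyticLogvVal T.K)).Packet j vQ))
      (ballImage : ℤ → ℤ → ∀ (j : (thetaIndexOfInitial T.D).Label) (vQ : (thetaIndexOfInitial T.D).VQ),
        Set ((logShellsOfInitialDH T.D (analyticLogvVal T.K)).Packet j vQ))
      (thetaDiv : ℤ → ℤ → LgpDivisor M (thetaIndexOfInitial T.D).lstar)
      (n : ℤ) {HT : Type} {LogLink : HT → HT → Type} {IsFull : ∀ {s t : HT}, LogLink s t → Prop}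
      (lat : LGPGaussianLogThetaLattice LogLink IsFull)
      {Frd : Type} {IsoF : Frd → Frd → Type} {Ob : Frd → Type} {realify : Frd → Frd} {Strip : Type}
      {IsoS : Strip → Strip → Type} {Mv : ∀ v : (thetaIndexOfInitial T.D).V, v ∈ (thetaIndexOfInitial T.D).Vbad → Type}
      [∀ v h, Monoid (Mv v h)]
      (sig : GlobalLGPFrobenioidSignature (thetaIndexOfInitial T.D).lstar (thetaIndexOfInitial T.D).V
        (· ∈ (thetaIndexOfInitial T.D).Vbad) Frd IsoF Ob realify Strip IsoS Mv)
      (split : SplittingMonoids Mv) {ObΔ : Type} {N : ∀ v : (thetaIndexOfInitial T.D).V, v ∈ (thetaIndexOfInitial T.D).Vbad → Type}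
      [∀ v h, Monoid (N v h)] (qData : QPilotData ObΔ N)
      (qK : ∀ v : (thetaIndexOfInitial T.D).V, v ∈ (thetaIndexOfInitial T.D).Vbad →
        Set ((logShellsOfInitialDH T.D (analyticLogvVal T.K)).StarPacket v)),
      ¬ Cor312Vol.PilotKummerCompatHull
        (LatticeSituation.ofShells (logShellsOfInitialDH T.D (analyticLogvVal T.K)) M archPk archSub
          (summandPiecesPrM T.D (logvAnalyticVal_analyticLogvVal (K := T.K))).Adm (summandPiecesPrM T.D (logvAnalyticVal_analyticLogvVal (K := T.K))).logvol Ψ act Mmod region frobAdm frobLogvol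
          frobΨ frobMmod unitImage ballImage thetaDiv)
        (settingPrVolSharpM T.D (logvAnalyticVal_analyticLogvVal (K := T.K)) (tOfIdeleData T.D (ideleDataOf T.D T.isVolumeInputOf))
          (fun u x => tqM T.D (ratChar u) u (natCast_ratChar_mem u) (ideleDataOf T.D T.isVolumeInputOf) x) M archPk archSub Ψ act Mmod region n lat sig split qData
          (fun u x => tqM_ne_zero T.D (ratChar u) u (natCast_ratChar_mem u) (ideleDataOf T.D T.isVolumeInputOf) x)
          (GenuineM.finite_ratPlaces_under_S T.D).toFinset
          (fun u x hu => norm_tqM_eq_one_of_not_mem T.D (ratChar u) u (natCast_ratChar_mem u) (ideleDataOf T.D T.isVolumeInputOf) x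
            fun hx => hu ((Set.Finite.mem_toFinset _).mpr ⟨x, hx⟩)))
        (fun _ => Cor312.Setting.qRegion
          (settingPrVolSharpM T.D (logvAnalyticVal_analyticLogvVal (K := T.K)) (tOfIdeleData T.D (ideleDataOf T.D T.isVolumeInputOf))
          (fun u x => tqM T.D (ratChar u) u (natCast_ratChar_mem u) (ideleDataOf T.D T.isVolumeInputOf) x) M archPk archSub Ψ act Mmod region n lat sig split qData
          (fun u x => tqM_ne_zero T.D (ratChar u) u (natCast_ratChar_mem u) (ideleDataOf T.D T.isVolumeInputOf) x)
          (GenuineM.finite_ratPlaces_under_S T.D).toFinset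
          (fun u x hu => norm_tqM_eq_one_of_not_mem T.D (ratChar u) u (natCast_ratChar_mem u) (ideleDataOf T.D T.isVolumeInputOf) x
            fun hx => hu ((Set.Finite.mem_toFinset _).mpr ⟨x, hx⟩)))) qK := by
  classical
  letI := T.instFieldF; letI := T.instNumberFieldF; letI := T.instAlgebraF; letI := T.instFieldK
  letI := T.instNumberFieldK; letI := T.instAlgebraK; letI := T.instFieldFbar; letI := T.instAlgebraFbar
  letI := T.instAlgebraKFbar; letI := T.instIsElliptic
  intro M _ _ archPk archSub Ψ act Mmod region frobAdm frobLogvol frobΨ frobMmod unitImage ballImage thetaDiv n HT LogLink IsFull lat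
    Frd IsoF Ob realify Strip IsoS Mv _ sig split ObΔ N _ qData qK
  set p : ℕ := ratChar u with hpdef
  haveI hpfact : Fact p.Prime := inferInstance
  obtain ⟨v, hv⟩ := (thetaIndexOfInitial T.D).fibre_nonempty (Val.non u)
  set x₀ : (thetaIndexOfInitial T.D).Fibre (Val.non u) := ⟨v, hv⟩ with hx₀def
  -- the label
  have hlstar : (thetaIndexOfInitial T.D).lstar = (l - 1) / 2 := rfl
  have hlt : i₀ < (thetaIndexOfInitial T.D).lstar := by rw [hlstar]; omega
  have hl : l.Prime := T.D.l_prime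
  have hl5 : 5 ≤ l := T.D.five_le_l
  obtain ⟨p', hp'⟩ : ∃ p', p = p' + 3 := ⟨p - 3, by have := hpfact.out.two_le; omega⟩
  have hp2' : 2 < p := by omega
  have hp0 : (0 : ℝ) < (p : ℝ) := by exact_mod_cast hpfact.out.pos
  have hp1 : (1 : ℝ) < (p : ℝ) := by exact_mod_cast hpfact.out.one_lt
  -- `‖t_q(x₀)‖ ≤ p^{−h/(2l)}` at the member (every member is bad)
  obtain ⟨-, hnorm⟩ := placeModOfM_mem_S_and_norm_tqM_le_of_ratPoint T.D p u (natCast_ratChar_mem u)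
    (ideleDataOf T.D T.isVolumeInputOf) q T.j_eq T.isP5Choice x₀ hp2 hpl h hh hord
  -- local type at the `K`-place under the member: `e ∣ 30·l`, `p ∤ e`
  have hpole : ∀ u' : HeightOneSpectrum (𝓞 ℚ), Rat.HeightOneSpectrum.natGenerator u' = p → ord ℚ u' (Cor22.jInv q) < 0 :=
    fun u' hu' => lt_of_le_of_lt (hord u' hu') (by omega)
  have hnot : p ∉ ({2, 3, 5, l} : Finset ℕ) := by
    simp only [Finset.mem_insert, Finset.mem_singleton, not_or]
    exact ⟨hp2, hp3, hp5, hpl⟩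
  set w := placeOfM T.D u x₀ with hwdef
  have hpw : ((p : ℕ) : 𝓞 T.K) ∈ w.asIdeal := natCast_mem_placeOfM T.D p u (natCast_ratChar_mem u) x₀
  have hwchar : residueChar T.K w = p := residueChar_eq_of_natCast_mem p hpw
  have hdvd : w.asIdeal.ramificationIdx ℤ ∣ 30 * l := T.ramificationIdx_int_dvd_thirty_mul_ratPoint' hnot hpole w hwchar
  set e : ℕ := absRamificationIdx p (kOfM T.D p u (natCast_ratChar_mem u) x₀) with hedef
  have heK : e = w.asIdeal.ramificationIdx ℤ := absRamificationIdx_rescaledCompletion T.K p w hpw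
  have hndvd : ¬ p ∣ e := by
    rw [heK]; exact LinUniformM.not_dvd_of_dvd_thirty_mul hpfact.out hl hp2 hp3 hp5 hpl hdvd
  have he0 : 0 < e := absRamificationIdx_pos p _
  have hel : e < p ^ B * (p - 1) := by
    have : e ≤ 30 * l := by rw [heK]; exact Nat.le_of_dvd (by omega) hdvd
    omega
  have hdab := depthConstants_le_of_not_dvd_of_lt_pow p (kOfM T.D p u (natCast_ratChar_mem u) x₀) hp2' hndvd hel
  set dab : ℝ := differentOrd p (kOfM T.D p u (natCast_ratChar_mem u) x₀) + logRadiusA p e + logRadiusB p e with hdabdef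
  have he' : (0 : ℝ) < (e : ℝ) := by exact_mod_cast he0
  have h1e : 0 < 1 / (e : ℝ) := by positivity
  have hi0 : (0 : ℝ) < (i₀ : ℝ) + 2 := by positivity
  -- the integer test over `ℝ`
  have htestR : ((i₀ : ℝ) + 2) * ((B : ℝ) + 1 + 1 / ((p : ℝ) - 2)) + 1 ≤ (h : ℝ) / (2 * l) * ((i₀ : ℝ) * ((i₀ : ℝ) + 2)) := by
    have hc : ((p : ℝ) - 2) = (p' : ℝ) + 1 := by rw [hp']; push_cast; ring
    have key : (2 * (l : ℝ)) * (((i₀ : ℝ) + 2) * (((B : ℝ) + 1) * ((p' : ℝ) + 1) + 1) + ((p' : ℝ) + 1)) ≤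
        (h : ℝ) * ((i₀ : ℝ) * ((i₀ : ℝ) + 2)) * ((p' : ℝ) + 1) := by
      have h1 : p - 2 = p' + 1 := by omega
      rw [h1] at htest
      exact_mod_cast htest
    rw [hc]
    rw [show ((i₀ : ℝ) + 2) * ((B : ℝ) + 1 + 1 / ((p' : ℝ) + 1)) + 1 =
        ((2 * (l : ℝ)) * (((i₀ : ℝ) + 2) * (((B : ℝ) + 1) * ((p' : ℝ) + 1) + 1) + ((p' : ℝ) + 1))) /
          ((2 * (l : ℝ)) * ((p' : ℝ) + 1)) by field_simp]
    rw [show (h : ℝ) / (2 * l) * ((i₀ : ℝ) * ((i₀ : ℝ) + 2)) =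
        ((h : ℝ) * ((i₀ : ℝ) * ((i₀ : ℝ) + 2)) * ((p' : ℝ) + 1)) / ((2 * (l : ℝ)) * ((p' : ℝ) + 1)) by field_simp]
    exact div_le_div_of_nonneg_right key (by positivity)
  have hA : ((i₀ : ℝ) + 2) * dab + 1 < (h : ℝ) / (2 * l) * ((i₀ : ℝ) * ((i₀ : ℝ) + 2)) := by
    have h1 : ((i₀ : ℝ) + 2) * dab ≤ ((i₀ : ℝ) + 2) * ((B : ℝ) + 1 + 1 / ((p : ℝ) - 2) - 1 / (e : ℝ)) :=
      mul_le_mul_of_nonneg_left hdab hi0.le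
    nlinarith [mul_pos hi0 h1e]
  -- assemble `hdeep`
  set τ : ℝ := ‖tqM T.D p u (natCast_ratChar_mem u) (ideleDataOf T.D T.isVolumeInputOf) x₀‖ with hτdef
  have hτ0 : 0 ≤ τ := norm_nonneg _
  have hn : (i₀ + 1) ^ 2 - 1 = i₀ * (i₀ + 2) := by
    have : (i₀ + 1) ^ 2 = i₀ * (i₀ + 2) + 1 := by ring
    omega
  have hpow : τ ^ ((i₀ + 1) ^ 2 - 1) ≤ (p : ℝ) ^ ((-(h : ℝ) / (2 * l)) * ((i₀ : ℝ) * ((i₀ : ℝ) + 2))) := by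
    rw [hn]
    calc τ ^ (i₀ * (i₀ + 2)) ≤ ((p : ℝ) ^ (-(h : ℝ) / (2 * l))) ^ (i₀ * (i₀ + 2)) := pow_le_pow_left₀ hτ0 hnorm _
      _ = (p : ℝ) ^ ((-(h : ℝ) / (2 * l)) * ((i₀ : ℝ) * ((i₀ : ℝ) + 2))) := by
          rw [← Real.rpow_natCast, ← Real.rpow_mul hp0.le]
          push_cast
          ring_nf
  have hdeep : (p : ℝ) ^ ((((i₀ : ℕ) : ℝ) + 2) * dab + 1) * τ ^ (((i₀ : ℕ) + 1) ^ 2 - 1) < 1 := by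
    have hApos : 0 < (p : ℝ) ^ ((((i₀ : ℕ) : ℝ) + 2) * dab + 1) := Real.rpow_pos_of_pos hp0 _
    calc (p : ℝ) ^ ((((i₀ : ℕ) : ℝ) + 2) * dab + 1) * τ ^ (((i₀ : ℕ) + 1) ^ 2 - 1)
        ≤ (p : ℝ) ^ ((((i₀ : ℕ) : ℝ) + 2) * dab + 1) * (p : ℝ) ^ ((-(h : ℝ) / (2 * l)) * ((i₀ : ℝ) * ((i₀ : ℝ) + 2))) :=
          mul_le_mul_of_nonneg_left hpow hApos.le
      _ = (p : ℝ) ^ ((((i₀ : ℕ) : ℝ) + 2) * dab + 1 + (-(h : ℝ) / (2 * l)) * ((i₀ : ℝ) * ((i₀ : ℝ) + 2))) := (Real.rpow_add hp0 _ _).symm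
      _ < (p : ℝ) ^ (0 : ℝ) := by
          apply Real.rpow_lt_rpow_of_exponent_lt hp1
          have : (-(h : ℝ) / (2 * l)) * ((i₀ : ℝ) * ((i₀ : ℝ) + 2)) = -((h : ℝ) / (2 * l) * ((i₀ : ℝ) * ((i₀ : ℝ) + 2))) := by ring
          rw [this]
          linarith
      _ = 1 := Real.rpow_zero _
  exact GenuineMShrink2.not_pilotKummerCompatHull_of_explicit_depth T.D M archPk archSub Ψ act Mmod region frobAdm frobLogvol frobΨ frobMmod
    unitImage ballImage thetaDiv n lat sig split qData qK T.isVolumeInputOf u ⟨i₀, hlt⟩ x₀ hdeep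

end Summit.ABC.IUTFork.Conditional

end
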